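import Summits.ResolutionOfSingularities.ResolutionOfSingularities.Theorems.FrobeniusClosingSteerCore4IsoIsolFormal
import Summits.ResolutionOfSingularities.ResolutionOfSingularities.Theorems.FrobeniusClosingSteerCore4IsoIsolCompletion
import Literature.AlgebraicGeometry.Resolution.QuadraticTransformsRegular
import Mathlib.RingTheory.AdicCompletion.Completeness
import Mathlib.Algebra.CharP.Subring
import HarnessLib

/-!
# Crux `Steer` (stmt-16345), r8 `stub_core4Iso`, piece I `isol_transfer` — ASSEMBLY (DICT-SIGS statement)

OURS (campaign `res-hironaka`, rung L, slot W4.1, chain W4.1; replaces the role of no printed item; NOT a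
statement of the manuscript under review). Proves lead-1's DICT-SIGS signature `isol_transfer` verbatim
(abbreviations `FC2` / `centre` inlined): under a formal chart `φ : R → κ⟦X₁..X_d⟧` of a regular local
`R ⊆ O` dominated by `O` (perfect residue field, characteristic `p`) with `φ(centre)·κ⟦X⟧ = (X)`, a
Jacobian ideal `(δ f : δ ∈ Der_ℤ(R, R))` containing `centre ^ N` forces `(X) ^ N ≤ (∂₁ φf, …, ∂_d φf)`.

Assembly of the landed seams: Cohen coordinates `e : R̂ ≃ k'⟦Y⟧` and the adic extension `ψ : R̂ → κ⟦X⟧`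
of `φ` (`…IsoIsolCompletion`), `θ := ψ ∘ e⁻¹`; every `δ` extends to `R̂` and conjugates to a
`ℤ`-derivation of `k'⟦Y⟧`; `k'` (≅ residue field of `R`) is perfect; the FC2 shape gives `(X) ≤ (θ Y)`;
and the formal isolation transfer `map_pow_le_span_pderiv_of_span_X_le` (`…IsoIsolFormal`) concludes.
No `Theses.*` / `Cruxes.*` import. [folklore]
-/

noncomputable section

-- layout-mandated namespace `Summit.<Summit>.<Problem>.…` with Summit = Problem (single-conjunct summit)
set_option linter.dupNamespace false

open MvPowerSeries IsLocalRing
open Literature.AlgebraicGeometry.Resolution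

namespace Summit.ResolutionOfSingularities.ResolutionOfSingularities.Theorems.SwitchingDichotomy.Isol

/-- A field receiving a ring hom from a ring of prime characteristic `p` has characteristic `p`.
[folklore] -/
theorem charP_of_ringHom_of_prime {A F : Type*} [CommRing A] [Field F] (p : ℕ) [Fact p.Prime]
    [CharP A p] (g : A →+* F) : CharP F p :=
  (CharP.charP_iff_prime_eq_zero (Fact.out : p.Prime)).mpr (by rw [← map_natCast g, CharP.cast_eq_zero, map_zero])

/-- Perfectness of fields transports along a ring isomorphism (characteristic `p`). [folklore] -/
theorem perfectField_of_ringEquiv (p : ℕ) [Fact p.Prime] {F F' : Type*} [Field F] [Field F']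
    [CharP F p] [CharP F' p] [PerfectField F] (g : F ≃+* F') : PerfectField F' := by
  haveI : ExpChar F p := ExpChar.prime (Fact.out : p.Prime)
  haveI : ExpChar F' p := ExpChar.prime (Fact.out : p.Prime)
  haveI : PerfectRing F' p := PerfectRing.ofSurjective F' p fun y => by
    obtain ⟨z, hz⟩ := (bijective_frobenius F p).2 (g.symm y)
    refine ⟨g z, ?_⟩
    rw [frobenius_def, ← map_pow, ← frobenius_def, hz, g.apply_symm_apply]
  exact PerfectRing.toPerfectField F' p

/-- Conjugating a `ℤ`-derivation of `A` by a ring isomorphism `e : A ≃ k⟦Y⟧` gives a `ℤ`-derivation of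
`k⟦Y⟧` (stated for the power-series target so that the `ℤ`-algebra instance is the one of `k⟦Y⟧`).
[folklore] -/
theorem exists_derivation_conj_mvPowerSeries {A : Type*} [CommRing A] {σ k : Type*} [Field k]
    (e : A ≃+* MvPowerSeries σ k) (δ : Derivation ℤ A A) :
    ∃ δ' : Derivation ℤ (MvPowerSeries σ k) (MvPowerSeries σ k), ∀ a : A, δ' (e a) = e (δ a) := by
  let L : MvPowerSeries σ k →+ MvPowerSeries σ k := (e : A →+* MvPowerSeries σ k).toAddMonoidHom.comp
    (δ.toLinearMap.toAddMonoidHom.comp (e.symm : MvPowerSeries σ k →+* A).toAddMonoidHom)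
  have hL : ∀ b, L b = e (δ (e.symm b)) := fun b => rfl
  refine ⟨Derivation.mk' L.toIntLinearMap fun x y => ?_, fun a => ?_⟩
  · change L (x * y) = x • L y + y • L x
    simp only [hL, map_mul, Derivation.leibniz, smul_eq_mul, map_add, RingEquiv.apply_symm_apply]
  · change L (e a) = e (δ a)
    rw [hL, e.symm_apply_apply]

/-- **I `isol_transfer` (DICT-SIGS, chain W4.1; `FC2` and `centre` inlined).** Under a formal chart
`φ : R → κ⟦X₁..X_d⟧` of a regular local subring `R ⊆ O` dominated by `O` (perfect residue field,
characteristic `p`) whose centre generates `(X)`, a Jacobian ideal `(δ f : δ ∈ Der_ℤ(R,R))` containing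
`centre ^ N` forces `(X) ^ N ⊆ (∂₁ φf, …, ∂_d φf)`. [folklore] -/
theorem isol_transfer {K : Type} [Field K] (O : ValuationSubring K) {κ : Type} [Field κ]
    (p : ℕ) [Fact p.Prime] [CharP K p] [CharP κ p] [PerfectField κ]
    (R : Subring K) (hR : R ≤ O.toSubring) [IsRegularLocalRing R] (hdom : SubringDominates R O.toSubring)
    [PerfectField (IsLocalRing.ResidueField R)]
    (d : ℕ) (hd : (IsLocalRing.maximalIdeal R).spanFinrank = d) (φ : R →+* MvPowerSeries (Fin d) κ)
    (h2 : Ideal.map φ (Ideal.comap (Subring.inclusion hR) (IsLocalRing.maximalIdeal O)) =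
      Ideal.span (Set.range (X : Fin d → MvPowerSeries (Fin d) κ)))
    (f : R) (N : ℕ)
    (hN : Ideal.comap (Subring.inclusion hR) (IsLocalRing.maximalIdeal O) ^ N ≤
      Ideal.span (Set.range fun δ : Derivation ℤ R R => δ f)) :
    Ideal.span (Set.range (X : Fin d → MvPowerSeries (Fin d) κ)) ^ N ≤
      Ideal.span (Set.range fun l : Fin d => MvPowerSeries.pderiv l (φ f)) := by
  classical
  -- (0) the centre of `O` on the dominated `R` is the maximal ideal of `R`
  have hcen : Ideal.comap (Subring.inclusion hR) (IsLocalRing.maximalIdeal O) = maximalIdeal R := by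
    ext a
    rw [Ideal.mem_comap, (subringDominates_valuationSubring_iff hR).mp hdom a,
      ValuationSubring.valuation_lt_one_iff]
    rfl
  rw [hcen] at h2 hN
  -- (1) Cohen coordinates on the completion `A = R̂`
  set A := AdicCompletion (maximalIdeal R) R with hA
  obtain ⟨e⟩ := exists_ringEquiv_adicCompletion_mvPowerSeries p d hd (R := R)
  set k' := ResidueField A with hk'
  -- characteristic and perfectness of `k'`
  haveI : CharP A p := charP_of_injective_algebraMap (AdicCompletion.of_injective (maximalIdeal R) R) p
  haveI : CharP k' p := charP_of_ringHom_of_prime p (residue A)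
  haveI : CharP (ResidueField R) p := charP_of_ringHom_of_prime p (residue R)
  haveI : PerfectField k' :=
    perfectField_of_ringEquiv p (RingEquiv.ofBijective _ (AdicCompletion.residueField_map_bijective R))
  -- (2) the adic extension `ψ : A → κ⟦X⟧` of `φ` and `θ := ψ ∘ e⁻¹`
  have hφ : Ideal.map φ (maximalIdeal R) ≤ Ideal.span (Set.range (X : Fin d → MvPowerSeries (Fin d) κ)) :=
    h2.le
  obtain ⟨ψ, hψ⟩ := exists_ringHom_adicCompletion_extend (maximalIdeal R) _ φ hφ
  set θ : MvPowerSeries (Fin d) k' →+* MvPowerSeries (Fin d) κ := ψ.comp e.symm.toRingHom with hθdef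
  -- the structure map `χ : R → k'⟦Y⟧` and the bookkeeping identities
  set χ : R →+* MvPowerSeries (Fin d) k' := e.toRingHom.comp (algebraMap R A) with hχdef
  have hofalg : ∀ r : R, AdicCompletion.of (maximalIdeal R) R r = algebraMap R A r := fun r => by
    rw [AdicCompletion.algebraMap_apply, Algebra.algebraMap_self, RingHom.id_apply]
  have hθχ : θ.comp χ = φ := by
    ext r : 1
    simp only [hθdef, hχdef, RingHom.coe_comp, Function.comp_apply, RingEquiv.toRingHom_eq_coe,
      RingEquiv.coe_toRingHom, RingEquiv.symm_apply_apply]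
    rw [← hofalg, hψ]
  have hψalg : ψ.comp (algebraMap R A) = φ := by
    ext r : 1
    rw [RingHom.coe_comp, Function.comp_apply, ← hofalg, hψ]
  -- `ψ (𝔪_A) ⊆ (X)`
  have hmaxA : maximalIdeal A = Ideal.map (algebraMap R A) (maximalIdeal R) :=
    AdicCompletion.maximalIdeal_eq_map
  have hψmax : Ideal.map ψ (maximalIdeal A) ≤ Ideal.span (Set.range (X : Fin d → MvPowerSeries (Fin d) κ)) := by
    rw [hmaxA, Ideal.map_map, hψalg]
    exact hφ
  -- `e⁻¹ (𝔪_Y) ⊆ 𝔪_A`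
  have hesymm : ∀ y ∈ maximalIdeal (MvPowerSeries (Fin d) k'), e.symm y ∈ maximalIdeal A := fun y hy => by
    rw [IsLocalRing.mem_maximalIdeal, mem_nonunits_iff] at hy ⊢
    exact fun h => hy (by simpa using (isUnit_map_iff e (e.symm y)).mpr h)
  -- (3) `θ` sends variables into `(X)`: `hθ`
  have hθX : ∀ j, θ (X j) ∈ Ideal.span (Set.range (X : Fin d → MvPowerSeries (Fin d) κ)) := fun j => by
    rw [hθdef, RingHom.coe_comp, Function.comp_apply]
    exact hψmax (Ideal.mem_map_of_mem ψ (hesymm _ (X_mem_maximalIdeal k' (Fin d) j)))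
  have hθ : ∀ j, constantCoeff (θ (X j)) = 0 := fun j => by
    haveI : Finite (Fin d) := inferInstance
    have h := hθX j
    rw [← maximalIdeal_mvPowerSeries_eq_span] at h
    exact Literature.RingTheory.MvPowerSeries.Jets.mem_maximalIdeal_iff_constantCoeff_eq_zero.mp h
  -- (4) the FC2 shape `(X) ≤ (θ Y)`
  have hχmax : Ideal.map χ (maximalIdeal R) ≤ maximalIdeal (MvPowerSeries (Fin d) k') := by
    rw [hχdef, ← Ideal.map_map, ← hmaxA, Ideal.map_le_iff_le_comap]
    intro a ha
    rw [Ideal.mem_comap, IsLocalRing.mem_maximalIdeal, mem_nonunits_iff]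
    rw [IsLocalRing.mem_maximalIdeal, mem_nonunits_iff] at ha
    exact fun h => ha ((isUnit_map_iff e a).mp (by simpa using h))
  have hspan : Ideal.span (Set.range (X : Fin d → MvPowerSeries (Fin d) κ)) ≤
      Ideal.span (Set.range fun j : Fin d => θ (X j)) := by
    haveI : Finite (Fin d) := inferInstance
    calc Ideal.span (Set.range (X : Fin d → MvPowerSeries (Fin d) κ))
        = Ideal.map φ (maximalIdeal R) := h2.symm
      _ = Ideal.map θ (Ideal.map χ (maximalIdeal R)) := by rw [Ideal.map_map, hθχ]
      _ ≤ Ideal.map θ (maximalIdeal (MvPowerSeries (Fin d) k')) := Ideal.map_mono hχmax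
      _ = Ideal.span (Set.range fun j : Fin d => θ (X j)) := by
          rw [maximalIdeal_mvPowerSeries_eq_span, Ideal.map_span, ← Set.range_comp]
          rfl
  -- (5) derivations: `(χ 𝔪_R) ^ N ≤ (δ' g : δ' ∈ Der_ℤ k'⟦Y⟧)` with `g = χ f`
  have hI : Ideal.map χ (maximalIdeal R) ^ N ≤ Ideal.span (Set.range
      fun δ' : Derivation ℤ (MvPowerSeries (Fin d) k') (MvPowerSeries (Fin d) k') => δ' (χ f)) := by
    rw [← Ideal.map_pow]
    refine (Ideal.map_mono hN).trans ?_
    rw [Ideal.map_span, Ideal.span_le]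
    rintro _ ⟨_, ⟨δ, rfl⟩, rfl⟩
    -- `χ (δ f) = δ' (χ f)` for the conjugate `δ'` of the completed derivation
    obtain ⟨δ₁, hδ₁⟩ := exists_derivation_adicCompletion (maximalIdeal R) δ
    obtain ⟨δ₂, hδ₂⟩ := exists_derivation_conj_mvPowerSeries e δ₁
    refine Ideal.subset_span ⟨δ₂, ?_⟩
    simp only [hχdef, RingHom.coe_comp, Function.comp_apply, RingEquiv.toRingHom_eq_coe,
      RingEquiv.coe_toRingHom]
    rw [← hofalg, ← hofalg]
    exact (hδ₂ _).trans (congrArg e (hδ₁ f))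
  -- (6) the formal isolation transfer
  have key := map_pow_le_span_pderiv_of_span_X_le p θ hθ hspan (χ f) hI
  have hθχf : θ (χ f) = φ f := by rw [← hθχ]; rfl
  rw [Ideal.map_map, hθχ, h2, hθχf] at key
  exact key

end Summit.ResolutionOfSingularities.ResolutionOfSingularities.Theorems.SwitchingDichotomy.Isol

end
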